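import Summits.QuantumAdvantage.QuantumAdvantage.Theses.RandomOracleGauge

/-!
Strategist sketch (cstrat stmt-QuantumAdvantage-10748; LOCAL COPIES of the piece statements — the filed route decls are
`Summit.QuantumAdvantage.QuantumAdvantage.Theses.RandomOracleGauge.{DecoupledCoreAA, OneBlockDecoupling, VarianceAmplification}`,
verbatim the same Props): typed decomposition of the crux `AAConj`
(the Aaronson–Ambainis conjecture) of route RandomOracleGauge into three pieces

  DecoupledCoreAA      — AA for ONE-BLOCK-DECOUPLED polynomials in the POLYNOMIALLY-SMALL-VARIANCE regime (open core)
  OneBlockDecoupling   — O'Donnell–Zhao 2016 (arXiv:1512.01603 Cor. 2.12 + Thm. 2.13): every bounded degree-d p has a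
                         bounded one-block-decoupled companion q of degree ≤ d with Var p ≤ K d^κ Var q and every
                         influence of q ≤ K d^κ · (some influence of p)   (theorem in print; to formalise)
  VarianceAmplification — from Var p = ε build a bounded q of degree ≤ K d/ε^κ with Var q ≥ v (absolute) and every
                         influence of q ≤ (K/ε^κ) · (some influence of p)  (new elementary reduction; to prove)

and the assembly `AAConj_of_subs : DecoupledCoreAA → OneBlockDecoupling → VarianceAmplification → AAConj`.
-/

set_option linter.dupNamespace false

open Literature.Computability.QuantumComplexity

namespace Summit.QuantumAdvantage.QuantumAdvantage.Cruxes.AAConj.StrategistSketch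

open Summit.QuantumAdvantage.QuantumAdvantage.Theses.RandomOracleGauge (AAConj)

/-- Piece 1 (open core). The Aaronson–Ambainis conjecture RESTRICTED twice: (i) to one-block-decoupled
polynomials `q` on `N + N` variables — as a function on the cube, `q(y,z) = c₀ + Σ_i (±1)^{y_i} g_i(z)`
(O'Donnell–Zhao's `f̃`, up to an additive constant) — and (ii) to the regime `Var q ≥ 1/(K₀ d^κ₀)`,
with the influence bound `C/d^c` allowed to depend arbitrarily on the regime `(κ₀, K₀)`. -/
def DecoupledCoreAA : Prop :=
  ∀ (κ₀ : ℕ) (K₀ : ℝ), 0 < K₀ → ∃ (c : ℕ) (C : ℝ), 0 < C ∧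
    ∀ (N d : ℕ) (q : MvPolynomial (Fin (N + N)) ℝ),
      (∃ (c₀ : ℝ) (g : Fin N → (Fin N → Bool) → ℝ), ∀ (y z : Fin N → Bool),
          evalBool q (Fin.append y z) = c₀ + ∑ i, (if y i then (1 : ℝ) else -1) * g i z) →
      1 ≤ d → q.totalDegree ≤ d → (∀ x, 0 ≤ evalBool q x ∧ evalBool q x ≤ 1) →
      1 ≤ K₀ * (d : ℝ) ^ κ₀ * boolVariance q →
        ∃ j : Fin (N + N), C / (d : ℝ) ^ c ≤ influence j q

/-- Piece 2 (O'Donnell–Zhao one-block decoupling, arXiv:1512.01603 Cor. 2.12 / Thm. 2.13). -/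
def OneBlockDecoupling : Prop :=
  ∃ (κ : ℕ) (K : ℝ), 0 < K ∧ ∀ (N d : ℕ) (p : MvPolynomial (Fin N) ℝ), 1 ≤ d → p.totalDegree ≤ d →
    (∀ x, 0 ≤ evalBool p x ∧ evalBool p x ≤ 1) →
    ∃ q : MvPolynomial (Fin (N + N)) ℝ,
      (∃ (c₀ : ℝ) (g : Fin N → (Fin N → Bool) → ℝ), ∀ (y z : Fin N → Bool),
          evalBool q (Fin.append y z) = c₀ + ∑ i, (if y i then (1 : ℝ) else -1) * g i z) ∧
      q.totalDegree ≤ d ∧ (∀ x, 0 ≤ evalBool q x ∧ evalBool q x ≤ 1) ∧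
      boolVariance p ≤ K * (d : ℝ) ^ κ * boolVariance q ∧
      ∀ j : Fin (N + N), ∃ i : Fin N, influence j q ≤ K * (d : ℝ) ^ κ * influence i p

/-- Piece 3 (variance amplification to an absolute level at polynomial cost in `1/ε`). -/
def VarianceAmplification : Prop :=
  ∃ (v K : ℝ) (κ : ℕ), 0 < v ∧ 0 < K ∧ ∀ (N d : ℕ) (p : MvPolynomial (Fin N) ℝ) (ε : ℝ), 1 ≤ d →
    p.totalDegree ≤ d → (∀ x, 0 ≤ evalBool p x ∧ evalBool p x ≤ 1) → 0 < ε → ε ≤ boolVariance p →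
    ∃ (N' D : ℕ) (q : MvPolynomial (Fin N') ℝ), 1 ≤ D ∧ (D : ℝ) ≤ K * d / ε ^ κ ∧
      q.totalDegree ≤ D ∧ (∀ x, 0 ≤ evalBool q x ∧ evalBool q x ≤ 1) ∧ v ≤ boolVariance q ∧
      ∀ j : Fin N', ∃ i : Fin N, influence j q ≤ K / ε ^ κ * influence i p

/-! ### Bookkeeping: the variance of a `[0,1]`-bounded polynomial is at most `1` -/

theorem boolAvg_le_one' {N : ℕ} {f : (Fin N → Bool) → ℝ} (hf : ∀ x, f x ≤ 1) : boolAvg f ≤ 1 := by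
  unfold boolAvg
  rw [div_le_one (by positivity)]
  calc ∑ x, f x ≤ ∑ _x : Fin N → Bool, (1 : ℝ) := Finset.sum_le_sum fun x _ => hf x
    _ = 2 ^ N := by simp

theorem boolVariance_le_one' {N : ℕ} {p : MvPolynomial (Fin N) ℝ}
    (hb : ∀ x, 0 ≤ evalBool p x ∧ evalBool p x ≤ 1) : boolVariance p ≤ 1 := by
  have hμ0 : 0 ≤ boolAvg (evalBool p) := boolAvg_nonneg fun x => (hb x).1
  have hμ1 : boolAvg (evalBool p) ≤ 1 := boolAvg_le_one' fun x => (hb x).2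
  unfold boolVariance
  refine boolAvg_le_one' fun x => ?_
  have h0 := (hb x).1
  have h1 := (hb x).2
  nlinarith

/-! ### The assembly -/

/-- `DecoupledCoreAA ∧ OneBlockDecoupling ∧ VarianceAmplification ⟹ AAConj`.
Given `p` of degree `≤ d` with `Var p ≥ ε`: amplify (`q₁`, degree `≤ D ≤ K₁ d/ε^κ₁`, `Var q₁ ≥ v`),
decouple (`q₂`, degree `≤ D`, `v ≤ Var q₁ ≤ K₂ D^κ₂ Var q₂`), apply the core in the regime
`(κ₂, K₂/v)` to get a variable of `q₂` with influence `≥ C/D^c`, and pull the influence back through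
the two comparison clauses: `Inf_i p ≥ C ε^{κ₁} /(K₁ K₂ D^{c+κ₂}) ≥ C'·(ε/d)^{c'}`. -/
theorem AAConj_of_subs (hCore : DecoupledCoreAA) (hOZ : OneBlockDecoupling)
    (hAmp : VarianceAmplification) : AAConj := by
  obtain ⟨v, K₁, κ₁, hv, hK₁, hA⟩ := hAmp
  obtain ⟨κ₂, K₂, hK₂, hO⟩ := hOZ
  obtain ⟨c, C, hC, hX⟩ := hCore κ₂ (K₂ / v) (div_pos hK₂ hv)
  -- the constants of AAConj
  obtain ⟨e, he⟩ : ∃ e : ℕ, e = c + κ₂ := ⟨_, rfl⟩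
  refine ⟨κ₁ * (1 + e) + e, C / (K₂ * K₁ ^ (1 + e)), by positivity, ?_⟩
  intro N d p ε hd hp hb hε hεv
  have hε1 : ε ≤ 1 := hεv.trans (boolVariance_le_one' hb)
  have hd1 : (1 : ℝ) ≤ d := by exact_mod_cast hd
  have hd0 : (0 : ℝ) < d := by linarith
  -- amplify
  obtain ⟨N₁, D, q₁, hD1, hDle, hq₁deg, hq₁b, hq₁v, hq₁inf⟩ := hA N d p ε hd hp hb hε hεv
  have hD1' : (1 : ℝ) ≤ D := by exact_mod_cast hD1
  have hD0 : (0 : ℝ) < D := by linarith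
  -- decouple
  obtain ⟨q₂, hq₂dec, hq₂deg, hq₂b, hq₂var, hq₂inf⟩ := hO N₁ D q₁ hD1 hq₁deg hq₁b
  -- the core applies in the regime (κ₂, K₂ / v)
  have hreg : 1 ≤ K₂ / v * (D : ℝ) ^ κ₂ * boolVariance q₂ := by
    have h1 : v ≤ K₂ * (D : ℝ) ^ κ₂ * boolVariance q₂ := hq₁v.trans hq₂var
    have h2 : K₂ / v * (D : ℝ) ^ κ₂ * boolVariance q₂ = (K₂ * (D : ℝ) ^ κ₂ * boolVariance q₂) / v := by
      ring
    rw [h2, le_div_iff₀ hv, one_mul]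
    exact h1
  obtain ⟨j₂, hj₂⟩ := hX N₁ D q₂ hq₂dec hD1 hq₂deg hq₂b hreg
  obtain ⟨j₁, hj₁⟩ := hq₂inf j₂
  obtain ⟨i, hi⟩ := hq₁inf j₁
  refine ⟨i, ?_⟩
  set I : ℝ := influence i p with hI
  have hI0 : 0 ≤ I := influence_nonneg i p
  -- the chain `C / D^c ≤ K₂ D^κ₂ · (K₁/ε^κ₁) · I`
  have hchain : C / (D : ℝ) ^ c ≤ K₂ * (D : ℝ) ^ κ₂ * (K₁ / ε ^ κ₁ * I) :=
    hj₂.trans (hj₁.trans (mul_le_mul_of_nonneg_left hi (by positivity)))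
  -- hence `I ≥ C ε^κ₁ / (K₁ K₂ D^(c+κ₂))`
  have hεκ : 0 < ε ^ κ₁ := by positivity
  have hstep1 : C * ε ^ κ₁ / (K₁ * K₂ * (D : ℝ) ^ e) ≤ I := by
    rw [div_le_iff₀ (by positivity)]
    have h3 : C ≤ K₂ * (D : ℝ) ^ κ₂ * (K₁ / ε ^ κ₁ * I) * (D : ℝ) ^ c := by
      have := hchain
      rwa [div_le_iff₀ (by positivity)] at this
    have h4 : K₂ * (D : ℝ) ^ κ₂ * (K₁ / ε ^ κ₁ * I) * (D : ℝ) ^ c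
        = (I * (K₁ * K₂ * (D : ℝ) ^ e)) / ε ^ κ₁ := by
      rw [he, pow_add]; field_simp
    rw [h4, le_div_iff₀ hεκ] at h3
    linarith
  -- and `D ≤ K₁ d / ε^κ₁` turns `D^e` into `(K₁ d/ε^κ₁)^e`
  have hDpow : (D : ℝ) ^ e ≤ (K₁ * d / ε ^ κ₁) ^ e := pow_le_pow_left₀ hD0.le hDle e
  have hstep2 : C * ε ^ κ₁ / (K₁ * K₂ * (K₁ * d / ε ^ κ₁) ^ e) ≤ C * ε ^ κ₁ / (K₁ * K₂ * (D : ℝ) ^ e) := by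
    apply div_le_div_of_nonneg_left (by positivity) (by positivity)
    exact mul_le_mul_of_nonneg_left hDpow (by positivity)
  -- rewrite the left-hand side as `C'·ε^{κ₁(1+e)}/d^e`
  have hrew : C * ε ^ κ₁ / (K₁ * K₂ * (K₁ * d / ε ^ κ₁) ^ e)
      = C / (K₂ * K₁ ^ (1 + e)) * (ε ^ (κ₁ * (1 + e)) / (d : ℝ) ^ e) := by
    rw [div_pow, mul_pow, ← pow_mul]
    field_simp
    ring
  -- compare with the AAConj-shaped bound
  have hfinal : C / (K₂ * K₁ ^ (1 + e)) * (ε / d) ^ (κ₁ * (1 + e) + e)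
      ≤ C / (K₂ * K₁ ^ (1 + e)) * (ε ^ (κ₁ * (1 + e)) / (d : ℝ) ^ e) := by
    apply mul_le_mul_of_nonneg_left _ (by positivity)
    rw [div_pow]
    have hnum : ε ^ (κ₁ * (1 + e) + e) ≤ ε ^ (κ₁ * (1 + e)) :=
      pow_le_pow_of_le_one hε.le hε1 (Nat.le_add_right _ _)
    have hden : (d : ℝ) ^ e ≤ (d : ℝ) ^ (κ₁ * (1 + e) + e) :=
      pow_le_pow_right₀ hd1 (Nat.le_add_left _ _)
    exact div_le_div₀ (by positivity) hnum (by positivity) hden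
  calc C / (K₂ * K₁ ^ (1 + e)) * (ε / d) ^ (κ₁ * (1 + e) + e)
      ≤ C / (K₂ * K₁ ^ (1 + e)) * (ε ^ (κ₁ * (1 + e)) / (d : ℝ) ^ e) := hfinal
    _ = C * ε ^ κ₁ / (K₁ * K₂ * (K₁ * d / ε ^ κ₁) ^ e) := hrew.symm
    _ ≤ C * ε ^ κ₁ / (K₁ * K₂ * (D : ℝ) ^ e) := hstep2
    _ ≤ I := hstep1

/-- Fallback assembly without the amplification piece: the full one-block-decoupled conjecture
(`∀ ε`) and O'Donnell–Zhao already give `AAConj` (OZ Thm. 2.13). Recorded so that a resplit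
`{DecoupledAA, OneBlockDecoupling}` has its glue proved. -/
def DecoupledAA : Prop :=
  ∃ (c : ℕ) (C : ℝ), 0 < C ∧ ∀ (N d : ℕ) (q : MvPolynomial (Fin (N + N)) ℝ) (ε : ℝ),
    (∃ (c₀ : ℝ) (g : Fin N → (Fin N → Bool) → ℝ), ∀ (y z : Fin N → Bool),
        evalBool q (Fin.append y z) = c₀ + ∑ i, (if y i then (1 : ℝ) else -1) * g i z) →
    1 ≤ d → q.totalDegree ≤ d → (∀ x, 0 ≤ evalBool q x ∧ evalBool q x ≤ 1) → 0 < ε →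
    ε ≤ boolVariance q → ∃ j : Fin (N + N), C * (ε / d) ^ c ≤ influence j q

theorem AAConj_of_decoupled (hDec : DecoupledAA) (hOZ : OneBlockDecoupling) : AAConj := by
  obtain ⟨c, C, hC, hX⟩ := hDec
  obtain ⟨κ, K, hK, hO⟩ := hOZ
  refine ⟨c * (1 + κ) + κ, C / K ^ (1 + c), by positivity, ?_⟩
  intro N d p ε hd hp hb hε hεv
  have hε1 : ε ≤ 1 := hεv.trans (boolVariance_le_one' hb)
  have hd1 : (1 : ℝ) ≤ d := by exact_mod_cast hd
  have hd0 : (0 : ℝ) < d := by linarith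
  obtain ⟨q, hqdec, hqdeg, hqb, hqvar, hqinf⟩ := hO N d p hd hp hb
  have hKd : 0 < K * (d : ℝ) ^ κ := by positivity
  -- Var q ≥ ε / (K d^κ)
  have hεq : ε / (K * (d : ℝ) ^ κ) ≤ boolVariance q := by
    rw [div_le_iff₀ hKd]
    calc ε ≤ boolVariance p := hεv
      _ ≤ K * (d : ℝ) ^ κ * boolVariance q := hqvar
      _ = boolVariance q * (K * (d : ℝ) ^ κ) := by ring
  obtain ⟨j, hj⟩ := hX N d q (ε / (K * (d : ℝ) ^ κ)) hqdec hd hqdeg hqb (by positivity) hεq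
  obtain ⟨i, hi⟩ := hqinf j
  refine ⟨i, ?_⟩
  set I : ℝ := influence i p with hI
  have hchain : C * (ε / (K * (d : ℝ) ^ κ) / d) ^ c ≤ K * (d : ℝ) ^ κ * I := hj.trans hi
  have hstep1 : C * (ε / (K * (d : ℝ) ^ κ) / d) ^ c / (K * (d : ℝ) ^ κ) ≤ I := by
    rw [div_le_iff₀ hKd]; linarith
  have hrew : C * (ε / (K * (d : ℝ) ^ κ) / d) ^ c / (K * (d : ℝ) ^ κ)
      = C / K ^ (1 + c) * (ε ^ c / (d : ℝ) ^ (c * (1 + κ) + κ)) := by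
    rw [div_div, div_pow, mul_pow, mul_pow, ← pow_mul]
    field_simp
    ring
  have hfinal : C / K ^ (1 + c) * (ε / d) ^ (c * (1 + κ) + κ)
      ≤ C / K ^ (1 + c) * (ε ^ c / (d : ℝ) ^ (c * (1 + κ) + κ)) := by
    apply mul_le_mul_of_nonneg_left _ (by positivity)
    rw [div_pow]
    have hnum : ε ^ (c * (1 + κ) + κ) ≤ ε ^ c :=
      pow_le_pow_of_le_one hε.le hε1 (by nlinarith [Nat.zero_le (c * κ), Nat.zero_le κ])
    exact div_le_div_of_nonneg_right hnum (by positivity)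
  calc C / K ^ (1 + c) * (ε / d) ^ (c * (1 + κ) + κ)
      ≤ C / K ^ (1 + c) * (ε ^ c / (d : ℝ) ^ (c * (1 + κ) + κ)) := hfinal
    _ = C * (ε / (K * (d : ℝ) ^ κ) / d) ^ c / (K * (d : ℝ) ^ κ) := hrew.symm
    _ ≤ I := hstep1

/-- Sanity: the crux trivially gives back the core piece (the core IS a special case). -/
theorem decoupledCoreAA_of_AAConj (h : AAConj) : DecoupledCoreAA := by
  intro κ₀ K₀ hK₀
  obtain ⟨c, C, hC, hAA⟩ := h
  refine ⟨c * (κ₀ + 1), C / K₀ ^ c, by positivity, ?_⟩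
  intro N d q _hdec hd hdeg hb hreg
  have hd1 : (1 : ℝ) ≤ d := by exact_mod_cast hd
  have hpos : 0 < K₀ * (d : ℝ) ^ κ₀ := by positivity
  have hε : 1 / (K₀ * (d : ℝ) ^ κ₀) ≤ boolVariance q := by
    rw [div_le_iff₀ hpos]; linarith
  obtain ⟨j, hj⟩ := hAA (N + N) d q (1 / (K₀ * (d : ℝ) ^ κ₀)) hd hdeg hb (by positivity) hε
  refine ⟨j, le_trans (le_of_eq ?_) hj⟩
  have hd0 : (0 : ℝ) < d := by linarith
  ring

end Summit.QuantumAdvantage.QuantumAdvantage.Cruxes.AAConj.StrategistSketch
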